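import Literature.Geometry.Riemannian.PinchingEstimatesCriticalPairs
import Literature.Geometry.Riemannian.PinchingEstimatesFrobenius
import Literature.Geometry.Riemannian.PinchingEstimatesPreserved
import HarnessLib

/-!
# Hamilton 1997, Thm. 1.4 at the extremal pairs: the pointwise differential inequality
(topic `Geometry/Riemannian`)

Part of the decomposition of `Literature.Geometry.Riemannian.hamilton_chenZhu_pinching`
(`PinchingEstimates.lean`). Hamilton 1997, §2.1, Thm. 1.4 (p. 8): "There exist a constant
`Φ < ∞` depending only on the initial metric such that `a₃ ≤ Φ a₁` and `c₃ ≤ Φ c₁`"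
(precisely: `a₂ + a₃ ≤ Φ (a₁ + a₂)`), with the proof (pp. 8–9):
"`d/dt (a₂ + a₃) ≤ a₂² + a₃² + 2a₁(a₂ + a₃) + b₂² + b₃²` … `(b₂ + b₃)² ≤ Λ(a₁ + a₂)(c₁ + c₂)` and
`c₁ + c₂ ≤ a₂ + a₃` makes `b₂² + b₃² ≤ Λ(a₁ + a₂)(a₂ + a₃)` … `a₂² + a₃² ≤ a₃(a₂ + a₃)` …
`d/dt log (a₂ + a₃) ≤ a₃ + 2a₁ + Λ(a₁ + a₂)` … `a₁² + a₂² ≥ a₁(a₁ + a₂)` …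
`d/dt log (a₁ + a₂) ≥ a₁ + 2a₃` … `d/dt log ((a₂ + a₃)/(a₁ + a₂)) ≤ (Λ + 1)(a₁ + a₂) - (a₂ + a₃)`
… if `Φ ≥ Λ + 1` the inequality is preserved."

In the tree's variational language (`Matrix.TwoLargestEigenvaluesSumLE`: `uᵀAu + vᵀAv ≤
Φ (wᵀAw + w'ᵀAw')` for all orthonormal pairs) the preserved quantity is the minimum over
`((u, v), (w, w')) ∈ pairSet × pairSet` of `G = Φ X(w, w') - X(u, v)`, `X(u, v) = uᵀAu + vᵀAv`;
at a minimiser, `(w, w')` minimises `X` (`a₁ + a₂`) and `(u, v)` maximises it (`a₂ + a₃`).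
PROVED here: the decoupling (`isMinOn_snd_of_isMinOn_G`, `isMaxOn_fst_of_isMinOn_G`), the
first-order conditions at extremal pairs (`critical_of_isMinOn`, `critical_of_isMaxOn`), the
`B`-term bounds from `SingularValuesSumSqLE` for both blocks (`bTerm_le_A`, `bTerm_le_C`), and
the **pointwise form of Hamilton's inequality** `twoLargest_deriv_ge`:
`Φ X'(w, w') - X'(u, v) ≥ (3 tr A + (Λ - 1 - 3Φ) X(w, w')) · G` whenever `Φ ≥ Λ + 1`
(Hamilton's log-derivative inequality multiplied out), which feeds the barrier lemma
`minOverSet_nonneg_of_deriv` in `PinchingEstimatesTwoLargest.lean`.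

## References

* R. S. Hamilton, Comm. Anal. Geom. 5 (1997), §2.1, Thm. 1.4 and its proof (pp. 8–9). [Hamilton1997]
-/

noncomputable section

open Set Real
open scoped Matrix BigOperators

namespace Literature.Geometry.Riemannian

namespace HamiltonODE

variable {A B : Matrix (Fin 3) (Fin 3) ℝ}

/-! ### Extremal pairs: decoupling and first-order conditions -/

/-- The pair sum `X(u, v) = uᵀMu + vᵀMv`. [folklore] -/
abbrev pairSumQ (M : Matrix (Fin 3) (Fin 3) ℝ) (q : (Fin 3 → ℝ) × (Fin 3 → ℝ)) : ℝ :=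
  q.1 ⬝ᵥ (M *ᵥ q.1) + q.2 ⬝ᵥ (M *ᵥ q.2)

/-- Hamilton's Thm. 1.4 functional `G = Φ X(w, w') - X(u, v)` on `pairSet × pairSet`. [folklore] -/
def twoLargestG (Φ : ℝ) (M : Matrix (Fin 3) (Fin 3) ℝ)
    (q : ((Fin 3 → ℝ) × (Fin 3 → ℝ)) × ((Fin 3 → ℝ) × (Fin 3 → ℝ))) : ℝ :=
  Φ * pairSumQ M q.2 - pairSumQ M q.1

/-- `a₂ + a₃ ≤ Φ (a₁ + a₂)` iff `G ≥ 0` on `pairSet × pairSet`. [folklore] -/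
theorem twoLargestEigenvaluesSumLE_iff (Φ : ℝ) (M : Matrix (Fin 3) (Fin 3) ℝ) :
    M.TwoLargestEigenvaluesSumLE Φ ↔ ∀ q ∈ pairSet ×ˢ pairSet, 0 ≤ twoLargestG Φ M q := by
  constructor
  · rintro h ⟨⟨u, v⟩, ⟨w, w'⟩⟩ ⟨⟨hu, hv, huv⟩, ⟨hw, hw', hww'⟩⟩
    have := h u v w w' hu hv huv hw hw' hww'
    simp only [twoLargestG, pairSumQ]
    linarith
  · intro h u v w w' hu hv huv hw hw' hww'
    have := h ((u, v), (w, w')) ⟨⟨hu, hv, huv⟩, ⟨hw, hw', hww'⟩⟩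
    simp only [twoLargestG, pairSumQ] at this
    linarith

/-- At a minimiser of `G` (`Φ > 0`), the second pair minimises `X`. [folklore] -/
theorem isMinOn_snd_of_isMinOn_G {Φ : ℝ} (hΦ : 0 < Φ) {M : Matrix (Fin 3) (Fin 3) ℝ}
    {q : ((Fin 3 → ℝ) × (Fin 3 → ℝ)) × ((Fin 3 → ℝ) × (Fin 3 → ℝ))} (hq : q ∈ pairSet ×ˢ pairSet)
    (hmin : IsMinOn (twoLargestG Φ M) (pairSet ×ˢ pairSet) q) :
    ∀ r ∈ pairSet, pairSumQ M q.2 ≤ pairSumQ M r := by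
  intro r hr
  have h := hmin (show (q.1, r) ∈ pairSet ×ˢ pairSet from ⟨hq.1, hr⟩)
  simp only [mem_setOf_eq, twoLargestG] at h
  nlinarith

/-- At a minimiser of `G`, the first pair maximises `X`. [folklore] -/
theorem isMaxOn_fst_of_isMinOn_G {Φ : ℝ} {M : Matrix (Fin 3) (Fin 3) ℝ}
    {q : ((Fin 3 → ℝ) × (Fin 3 → ℝ)) × ((Fin 3 → ℝ) × (Fin 3 → ℝ))} (hq : q ∈ pairSet ×ˢ pairSet)
    (hmin : IsMinOn (twoLargestG Φ M) (pairSet ×ˢ pairSet) q) :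
    ∀ r ∈ pairSet, pairSumQ M r ≤ pairSumQ M q.1 := by
  intro r hr
  have h := hmin (show (r, q.2) ∈ pairSet ×ˢ pairSet from ⟨hr, hq.2⟩)
  simp only [mem_setOf_eq, twoLargestG] at h
  linarith

/-- **First-order conditions at a minimising pair**: `uᵀAn = vᵀAn = 0`, `n = u × v`. [folklore] -/
theorem critical_of_isMinOn (hA : A.IsSymm) {u v : Fin 3 → ℝ} (hu : u ⬝ᵥ u = 1) (hv : v ⬝ᵥ v = 1)
    (huv : u ⬝ᵥ v = 0) (hmin : ∀ r ∈ pairSet, pairSumQ A (u, v) ≤ pairSumQ A r) :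
    u ⬝ᵥ (A *ᵥ (u ⨯₃ v)) = 0 ∧ v ⬝ᵥ (A *ᵥ (u ⨯₃ v)) = 0 := by
  have hw1 : (u ⨯₃ v) ⬝ᵥ (u ⨯₃ v) = 1 := dotProduct_cross_self_of_orthonormal hu hv huv
  have huw : u ⬝ᵥ (u ⨯₃ v) = 0 := dot_self_cross u v
  have hvw : v ⬝ᵥ (u ⨯₃ v) = 0 := dot_cross_self u v
  constructor
  · refine (firstOrder_of_min hA (u := u) (y := u ⨯₃ v) fun t ↦ ?_).1
    have hmem : ((1 + t ^ 2)⁻¹.sqrt • (u + t • (u ⨯₃ v)), v) ∈ pairSet := by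
      refine ⟨variation_mem hu hw1 huw t, hv, ?_⟩
      simp [smul_dotProduct, add_dotProduct, huv, dotProduct_comm (u ⨯₃ v) v, hvw]
    have h := hmin _ hmem
    simp only [pairSumQ] at h
    linarith
  · refine (firstOrder_of_min hA (u := v) (y := u ⨯₃ v) fun t ↦ ?_).1
    have hmem : (u, (1 + t ^ 2)⁻¹.sqrt • (v + t • (u ⨯₃ v))) ∈ pairSet := by
      refine ⟨hu, variation_mem hv hw1 hvw t, ?_⟩
      simp [dotProduct_smul, dotProduct_add, huv, huw]
    have h := hmin _ hmem
    simp only [pairSumQ] at h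
    linarith

/-- **First-order conditions at a maximising pair.** [folklore] -/
theorem critical_of_isMaxOn (hA : A.IsSymm) {u v : Fin 3 → ℝ} (hu : u ⬝ᵥ u = 1) (hv : v ⬝ᵥ v = 1)
    (huv : u ⬝ᵥ v = 0) (hmax : ∀ r ∈ pairSet, pairSumQ A r ≤ pairSumQ A (u, v)) :
    u ⬝ᵥ (A *ᵥ (u ⨯₃ v)) = 0 ∧ v ⬝ᵥ (A *ᵥ (u ⨯₃ v)) = 0 := by
  have h := critical_of_isMinOn hA.neg hu hv huv (fun r hr ↦ by
    have := hmax r hr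
    simp only [pairSumQ, Matrix.neg_mulVec, dotProduct_neg] at this ⊢
    linarith)
  simpa [Matrix.neg_mulVec, dotProduct_neg] using h

/-! ### The `B`-terms: `b₂² + b₃² ≤ Λ (a₁ + a₂)(a₂ + a₃)` -/

/-- The maximal pair sum dominates `⅔ tr A`. [folklore] -/
theorem two_thirds_trace_le_of_max {M : Matrix (Fin 3) (Fin 3) ℝ} {q : (Fin 3 → ℝ) × (Fin 3 → ℝ)}
    (hmax : ∀ r ∈ pairSet, pairSumQ M r ≤ pairSumQ M q) : 2 / 3 * M.trace ≤ pairSumQ M q := by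
  have e0 : ![(1 : ℝ), 0, 0] ⬝ᵥ (M *ᵥ ![1, 0, 0]) = M 0 0 := by
    simp [Matrix.mulVec, dotProduct, Fin.sum_univ_three]
  have e1 : ![(0 : ℝ), 1, 0] ⬝ᵥ (M *ᵥ ![0, 1, 0]) = M 1 1 := by
    simp [Matrix.mulVec, dotProduct, Fin.sum_univ_three]
  have e2 : ![(0 : ℝ), 0, 1] ⬝ᵥ (M *ᵥ ![0, 0, 1]) = M 2 2 := by
    simp [Matrix.mulVec, dotProduct, Fin.sum_univ_three]
  have h01 := hmax (![1, 0, 0], ![0, 1, 0]) (by simp [pairSet, dotProduct, Fin.sum_univ_three])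
  have h02 := hmax (![1, 0, 0], ![0, 0, 1]) (by simp [pairSet, dotProduct, Fin.sum_univ_three])
  have h12 := hmax (![0, 1, 0], ![0, 0, 1]) (by simp [pairSet, dotProduct, Fin.sum_univ_three])
  simp only [pairSumQ, e0, e1, e2] at h01 h02 h12
  rw [Matrix.trace_fin_three]
  linarith

/-- **The `B`-terms at the maximising pair of `A`** (Hamilton, p. 8: "`b₂² + b₃² ≤ (b₂ + b₃)²
≤ Λ(a₁ + a₂)(c₁ + c₂)` and `c₁ + c₂ ≤ a₂ + a₃`"): under `SingularValuesSumSqLE (A, B, C) Λ`,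
`Λ ≥ 0`, `tr A = tr C`, for the maximising pair `(u, v)` of `A` and any orthonormal `(w, w')`
with `X(w, w') ≥ 0`: `|ᵗBu|² + |ᵗBv|² ≤ Λ X(w, w') X(u, v)`. [cite: Hamilton1997, §2.1, Thm. 1.4 (proof, p. 8)] -/
theorem bTerm_le_A {C : Matrix (Fin 3) (Fin 3) ℝ} {Λ : ℝ} (hΛ : 0 ≤ Λ)
    (h13 : SingularValuesSumSqLE (A, B, C) Λ) (htr : A.trace = C.trace) {u v w w' : Fin 3 → ℝ}
    (hu : u ⬝ᵥ u = 1) (hv : v ⬝ᵥ v = 1) (huv : u ⬝ᵥ v = 0) (hw : w ⬝ᵥ w = 1) (hw' : w' ⬝ᵥ w' = 1)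
    (hww' : w ⬝ᵥ w' = 0) (hx : 0 ≤ pairSumQ A (w, w'))
    (hmax : ∀ r ∈ pairSet, pairSumQ A r ≤ pairSumQ A (u, v)) :
    (Bᵀ *ᵥ u) ⬝ᵥ (Bᵀ *ᵥ u) + (Bᵀ *ᵥ v) ⬝ᵥ (Bᵀ *ᵥ v) ≤
      Λ * pairSumQ A (w, w') * pairSumQ A (u, v) := by
  obtain ⟨v₁, v₂, h₁, h₂, h₁₂, hle⟩ := exists_pair_mulTranspose_le_sq B u v
  obtain ⟨z, z', hz, hz', hzz', hC⟩ := exists_coordinatePair_le_two_thirds_trace C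
  have hS := h13 u v v₁ v₂ w w' z z' hu hv huv h₁ h₂ h₁₂ hw hw' hww' hz hz' hzz'
  simp only at hS
  have hy := two_thirds_trace_le_of_max hmax
  have hzy : z ⬝ᵥ (C *ᵥ z) + z' ⬝ᵥ (C *ᵥ z') ≤ pairSumQ A (u, v) := by rw [htr] at hy; linarith
  calc (Bᵀ *ᵥ u) ⬝ᵥ (Bᵀ *ᵥ u) + (Bᵀ *ᵥ v) ⬝ᵥ (Bᵀ *ᵥ v)
      ≤ (u ⬝ᵥ (B *ᵥ v₁) + v ⬝ᵥ (B *ᵥ v₂)) ^ 2 := hle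
    _ ≤ Λ * (w ⬝ᵥ (A *ᵥ w) + w' ⬝ᵥ (A *ᵥ w')) * (z ⬝ᵥ (C *ᵥ z) + z' ⬝ᵥ (C *ᵥ z')) := hS
    _ ≤ Λ * pairSumQ A (w, w') * pairSumQ A (u, v) :=
        mul_le_mul_of_nonneg_left hzy (mul_nonneg hΛ hx)

/-- **The `B`-terms at the maximising pair of `C`** ("`C` is the same": the `C`-equation is the
`A`-equation for `(C, ᵗB)`). [cite: Hamilton1997, §2.1, Thm. 1.4 (proof, p. 8)] -/
theorem bTerm_le_C {C : Matrix (Fin 3) (Fin 3) ℝ} {Λ : ℝ} (hΛ : 0 ≤ Λ)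
    (h13 : SingularValuesSumSqLE (A, B, C) Λ) (htr : A.trace = C.trace) {u v w w' : Fin 3 → ℝ}
    (hu : u ⬝ᵥ u = 1) (hv : v ⬝ᵥ v = 1) (huv : u ⬝ᵥ v = 0) (hw : w ⬝ᵥ w = 1) (hw' : w' ⬝ᵥ w' = 1)
    (hww' : w ⬝ᵥ w' = 0) (hx : 0 ≤ pairSumQ C (w, w'))
    (hmax : ∀ r ∈ pairSet, pairSumQ C r ≤ pairSumQ C (u, v)) :
    (Bᵀᵀ *ᵥ u) ⬝ᵥ (Bᵀᵀ *ᵥ u) + (Bᵀᵀ *ᵥ v) ⬝ᵥ (Bᵀᵀ *ᵥ v) ≤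
      Λ * pairSumQ C (w, w') * pairSumQ C (u, v) := by
  obtain ⟨v₁, v₂, h₁, h₂, h₁₂, hle⟩ := exists_pair_mulTranspose_le_sq Bᵀ u v
  obtain ⟨z, z', hz, hz', hzz', hA⟩ := exists_coordinatePair_le_two_thirds_trace A
  have hS := h13 v₁ v₂ u v z z' w w' h₁ h₂ h₁₂ hu hv huv hz hz' hzz' hw hw' hww'
  simp only at hS
  have hy := two_thirds_trace_le_of_max hmax
  have hzy : z ⬝ᵥ (A *ᵥ z) + z' ⬝ᵥ (A *ᵥ z') ≤ pairSumQ C (u, v) := by rw [← htr] at hy; linarith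
  have hval : u ⬝ᵥ (Bᵀ *ᵥ v₁) + v ⬝ᵥ (Bᵀ *ᵥ v₂) = v₁ ⬝ᵥ (B *ᵥ u) + v₂ ⬝ᵥ (B *ᵥ v) := by
    rw [Matrix.dotProduct_transpose_mulVec, Matrix.dotProduct_transpose_mulVec]
  calc (Bᵀᵀ *ᵥ u) ⬝ᵥ (Bᵀᵀ *ᵥ u) + (Bᵀᵀ *ᵥ v) ⬝ᵥ (Bᵀᵀ *ᵥ v)
      ≤ (u ⬝ᵥ (Bᵀ *ᵥ v₁) + v ⬝ᵥ (Bᵀ *ᵥ v₂)) ^ 2 := hle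
    _ = (v₁ ⬝ᵥ (B *ᵥ u) + v₂ ⬝ᵥ (B *ᵥ v)) ^ 2 := by rw [hval]
    _ ≤ Λ * (z ⬝ᵥ (A *ᵥ z) + z' ⬝ᵥ (A *ᵥ z')) * (w ⬝ᵥ (C *ᵥ w) + w' ⬝ᵥ (C *ᵥ w')) := hS
    _ ≤ Λ * pairSumQ C (w, w') * pairSumQ C (u, v) := by
        rw [mul_assoc, mul_assoc, mul_comm (pairSumQ C (w, w'))]
        exact mul_le_mul_of_nonneg_left (mul_le_mul_of_nonneg_right hzy hx) hΛ

/-! ### Hamilton's inequality for `G = Φ X(w, w') - X(u, v)` -/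

/-- Scaling a bound on unit vectors orthogonal to `n` to all vectors orthogonal to `n`. [folklore] -/
theorem quad_le_mul_of_unit {M : Matrix (Fin 3) (Fin 3) ℝ} {n : Fin 3 → ℝ} {L : ℝ}
    (h : ∀ z : Fin 3 → ℝ, z ⬝ᵥ z = 1 → z ⬝ᵥ n = 0 → z ⬝ᵥ (M *ᵥ z) ≤ L) (z : Fin 3 → ℝ)
    (hz : z ⬝ᵥ n = 0) : z ⬝ᵥ (M *ᵥ z) ≤ L * (z ⬝ᵥ z) := by
  by_cases hz0 : z = 0
  · simp [hz0]
  have hzz : 0 < z ⬝ᵥ z := lt_of_le_of_ne (Finset.sum_nonneg fun i _ ↦ mul_self_nonneg _)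
    (fun h ↦ hz0 (dotProduct_self_eq_zero.1 h.symm))
  have hzu : ((z ⬝ᵥ z)⁻¹.sqrt • z) ⬝ᵥ ((z ⬝ᵥ z)⁻¹.sqrt • z) = 1 := normalize_dot_self hz0
  have hzun : ((z ⬝ᵥ z)⁻¹.sqrt • z) ⬝ᵥ n = 0 := by rw [smul_dotProduct, hz, smul_zero]
  have h2 := h _ hzu hzun
  rw [quad_smul, Real.sq_sqrt (inv_nonneg.2 hzz.le), inv_mul_le_iff₀ hzz] at h2
  linarith

/-- Scaling non-negativity on unit vectors orthogonal to `n` to all vectors orthogonal to `n`.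
[folklore] -/
theorem quad_nonneg_of_unit {M : Matrix (Fin 3) (Fin 3) ℝ} {n : Fin 3 → ℝ}
    (h : ∀ z : Fin 3 → ℝ, z ⬝ᵥ z = 1 → z ⬝ᵥ n = 0 → 0 ≤ z ⬝ᵥ (M *ᵥ z)) (z : Fin 3 → ℝ)
    (hz : z ⬝ᵥ n = 0) : 0 ≤ z ⬝ᵥ (M *ᵥ z) := by
  have := quad_le_mul_of_unit (M := -M) (L := 0) (fun z hz1 hzn ↦ by
    have := h z hz1 hzn
    rw [Matrix.neg_mulVec, dotProduct_neg]; linarith) z hz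
  rw [Matrix.neg_mulVec, dotProduct_neg, zero_mul] at this
  linarith

/-- The scalar bookkeeping of Hamilton's log-derivative argument (Thm. 1.4, p. 9), multiplied
out: with `a₁ = T - y`, `a₃ = T - x`, `x' = Pm + Bm + 2a₃x ≥ a₁x + 2a₃x`,
`y' = PM + BM + 2a₁y ≤ a₃y + Λxy + 2a₁y`, one has
`Φx' - y' ≥ (3T + (Λ - 1 - 3Φ)x)(Φx - y) + Φ(Φ - Λ - 1)x² + 2(Φx - y)²`. [cite: Hamilton1997, §2.1, Thm. 1.4 (proof, p. 9)] -/
theorem twoLargest_scalar {T x y Φ Λ Pm PM Bm BM : ℝ} (hΦ : Λ + 1 ≤ Φ) (hΦ0 : 0 ≤ Φ)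
    (hlow : (T - y) * x ≤ Pm) (hhigh : PM ≤ (T - x) * y) (hBm : 0 ≤ Bm) (hBM : BM ≤ Λ * x * y) :
    (3 * T + (Λ - 1 - 3 * Φ) * x) * (Φ * x - y) ≤
      Φ * (Pm + Bm + 2 * (T - x) * x) - (PM + BM + 2 * (T - y) * y) := by
  have h1 := mul_le_mul_of_nonneg_left hlow hΦ0
  have h2 := mul_nonneg hΦ0 hBm
  have h3 : 0 ≤ Φ * (Φ - Λ - 1) * x ^ 2 := mul_nonneg (mul_nonneg hΦ0 (by linarith)) (sq_nonneg x)
  have h4 := sq_nonneg (Φ * x - y)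
  nlinarith

/-- **Hamilton 1997, Thm. 1.4: the differential inequality at the extremal pairs, multiplied
out.** Let `M` be symmetric with `m ≤ X` on orthonormal pairs (`a₁ + a₂ ≥ m > 0`), `(u, v)` a
maximising and `(w, w')` a minimising orthonormal pair of `X(·) = ·ᵀM· + ·ᵀM·`, with values
`y = X(u, v)` and `x = X(w, w')`, and suppose the `B`-terms at `(u, v)` satisfy
`|ᵗNu|² + |ᵗNv|² ≤ Λ x y`. Then for `M' = M² + NᵗN + 2M^#` and `Φ ≥ Λ + 1`, `Λ ≥ 0`:
`Φ X'(w, w') - X'(u, v) ≥ (3 tr M + (Λ - 1 - 3Φ) x)(Φ x - y)`. (Hamilton: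
`d/dt log (a₁ + a₂) ≥ a₁ + 2a₃`, `d/dt log (a₂ + a₃) ≤ a₃ + 2a₁ + Λ(a₁ + a₂)`, with
`a₃ = tr M - x`, `a₁ = tr M - y` the Rayleigh quotients of the two normals.)
[cite: Hamilton1997, §2.1, Thm. 1.4 (proof, pp. 8–9)] -/
theorem twoLargest_deriv_ge {M N : Matrix (Fin 3) (Fin 3) ℝ} (hM : M.IsSymm) {m Λ Φ : ℝ}
    (hm : 0 < m) (hΦ : Λ + 1 ≤ Φ) (hΦ0 : 0 ≤ Φ) (h12 : M.TwoSmallestEigenvaluesSumGE m)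
    {u v w w' : Fin 3 → ℝ} (hu : u ⬝ᵥ u = 1) (hv : v ⬝ᵥ v = 1) (huv : u ⬝ᵥ v = 0)
    (hw : w ⬝ᵥ w = 1) (hw' : w' ⬝ᵥ w' = 1) (hww' : w ⬝ᵥ w' = 0)
    (hmax : ∀ r ∈ pairSet, pairSumQ M r ≤ pairSumQ M (u, v))
    (hmin : ∀ r ∈ pairSet, pairSumQ M (w, w') ≤ pairSumQ M r)
    (hB : (Nᵀ *ᵥ u) ⬝ᵥ (Nᵀ *ᵥ u) + (Nᵀ *ᵥ v) ⬝ᵥ (Nᵀ *ᵥ v) ≤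
      Λ * pairSumQ M (w, w') * pairSumQ M (u, v)) :
    (3 * M.trace + (Λ - 1 - 3 * Φ) * pairSumQ M (w, w')) *
        (Φ * pairSumQ M (w, w') - pairSumQ M (u, v)) ≤
      Φ * pairSumQ (M * M + N * Nᵀ + (2 : ℝ) • M.sharp) (w, w') -
        pairSumQ (M * M + N * Nᵀ + (2 : ℝ) • M.sharp) (u, v) := by
  -- normals and first-order conditions
  have hnM1 : (u ⨯₃ v) ⬝ᵥ (u ⨯₃ v) = 1 := dotProduct_cross_self_of_orthonormal hu hv huv
  have hunM : u ⬝ᵥ (u ⨯₃ v) = 0 := dot_self_cross u v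
  have hvnM : v ⬝ᵥ (u ⨯₃ v) = 0 := dot_cross_self u v
  have hnm1 : (w ⨯₃ w') ⬝ᵥ (w ⨯₃ w') = 1 := dotProduct_cross_self_of_orthonormal hw hw' hww'
  have hwnm : w ⬝ᵥ (w ⨯₃ w') = 0 := dot_self_cross w w'
  have hw'nm : w' ⬝ᵥ (w ⨯₃ w') = 0 := dot_cross_self w w'
  obtain ⟨hXu, hXv⟩ := critical_of_isMaxOn hM hu hv huv hmax
  obtain ⟨hXw, hXw'⟩ := critical_of_isMinOn hM hw hw' hww' hmin
  have hmax' : ∀ y y' : Fin 3 → ℝ, y ⬝ᵥ y = 1 → y' ⬝ᵥ y' = 1 → y ⬝ᵥ y' = 0 →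
      y ⬝ᵥ (M *ᵥ y) + y' ⬝ᵥ (M *ᵥ y') ≤ u ⬝ᵥ (M *ᵥ u) + v ⬝ᵥ (M *ᵥ v) :=
    fun y y' hy hy' hyy' ↦ hmax (y, y') ⟨hy, hy', hyy'⟩
  have hmin' : ∀ y y' : Fin 3 → ℝ, y ⬝ᵥ y = 1 → y' ⬝ᵥ y' = 1 → y ⬝ᵥ y' = 0 →
      w ⬝ᵥ (M *ᵥ w) + w' ⬝ᵥ (M *ᵥ w') ≤ y ⬝ᵥ (M *ᵥ y) + y' ⬝ᵥ (M *ᵥ y') :=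
    fun y y' hy hy' hyy' ↦ hmin (y, y') ⟨hy, hy', hyy'⟩
  -- `a₁ = nMᵀ M nM ≤` every Rayleigh quotient `≤ a₃ = nmᵀ M nm`
  have ha1 : ∀ z : Fin 3 → ℝ, z ⬝ᵥ z = 1 → (u ⨯₃ v) ⬝ᵥ (M *ᵥ (u ⨯₃ v)) ≤ z ⬝ᵥ (M *ᵥ z) :=
    fun z hz ↦ normal_le_rayleigh_of_max hu hv hnM1 huv hunM hvnM hmax' hz
  have ha3 : ∀ z : Fin 3 → ℝ, z ⬝ᵥ z = 1 → z ⬝ᵥ (M *ᵥ z) ≤ (w ⨯₃ w') ⬝ᵥ (M *ᵥ (w ⨯₃ w')) :=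
    fun z hz ↦ rayleigh_le_normal_of_min hw hw' hnm1 hww' hwnm hw'nm hmin' hz
  have htrM := trace_eq_pair_add_normal (A := M) hu hv hnM1 huv hunM hvnM
  have htrm := trace_eq_pair_add_normal (A := M) hw hw' hnm1 hww' hwnm hw'nm
  have hxm : m ≤ w ⬝ᵥ (M *ᵥ w) + w' ⬝ᵥ (M *ᵥ w') := h12 w w' hw hw' hww'
  -- lower bound at the minimising pair: `|Mw|² + |Mw'|² ≥ a₁ x`
  have hlow : (u ⨯₃ v) ⬝ᵥ (M *ᵥ (u ⨯₃ v)) * (w ⬝ᵥ (M *ᵥ w) + w' ⬝ᵥ (M *ᵥ w')) ≤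
      (M *ᵥ w) ⬝ᵥ (M *ᵥ w) + (M *ᵥ w') ⬝ᵥ (M *ᵥ w') := by
    rw [normSq_pair_eq hM hw hw' hnm1 hww' hwnm hw'nm hXw hXw']
    exact lowEig_mul_le_normSq (ha1 w hw) (ha1 w' hw') (by linarith)
  -- upper bound at the maximising pair: `|Mu|² + |Mv|² ≤ a₃ y`
  have hposM : ∀ z : Fin 3 → ℝ, z ⬝ᵥ (u ⨯₃ v) = 0 → 0 ≤ z ⬝ᵥ (M *ᵥ z) := by
    refine quad_nonneg_of_unit fun z hz hzn ↦ ?_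
    have h1 := h12 (u ⨯₃ v) z hnM1 hz (by rw [dotProduct_comm]; exact hzn)
    have h2 := ha1 z hz
    linarith
  have hlamM : ∀ z : Fin 3 → ℝ, z ⬝ᵥ (u ⨯₃ v) = 0 →
      z ⬝ᵥ (M *ᵥ z) ≤ (w ⨯₃ w') ⬝ᵥ (M *ᵥ (w ⨯₃ w')) * (z ⬝ᵥ z) :=
    quad_le_mul_of_unit fun z hz _ ↦ ha3 z hz
  have hhigh : (M *ᵥ u) ⬝ᵥ (M *ᵥ u) + (M *ᵥ v) ⬝ᵥ (M *ᵥ v) ≤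
      (w ⨯₃ w') ⬝ᵥ (M *ᵥ (w ⨯₃ w')) * (u ⬝ᵥ (M *ᵥ u) + v ⬝ᵥ (M *ᵥ v)) :=
    normSq_le_highEig_mul hM hXu hXv hunM hvnM hposM hlamM
  have hBm : 0 ≤ (Nᵀ *ᵥ w) ⬝ᵥ (Nᵀ *ᵥ w) + (Nᵀ *ᵥ w') ⬝ᵥ (Nᵀ *ᵥ w') :=
    add_nonneg (Finset.sum_nonneg fun i _ ↦ mul_self_nonneg _)
      (Finset.sum_nonneg fun i _ ↦ mul_self_nonneg _)
  -- assemble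
  have eT1 : (u ⨯₃ v) ⬝ᵥ (M *ᵥ (u ⨯₃ v)) = M.trace - (u ⬝ᵥ (M *ᵥ u) + v ⬝ᵥ (M *ᵥ v)) := by
    rw [htrM]; ring
  have eT3 : (w ⨯₃ w') ⬝ᵥ (M *ᵥ (w ⨯₃ w')) = M.trace - (w ⬝ᵥ (M *ᵥ w) + w' ⬝ᵥ (M *ᵥ w')) := by
    rw [htrm]; ring
  rw [eT1] at hlow
  rw [eT3] at hhigh
  have key := twoLargest_scalar hΦ hΦ0 hlow hhigh hBm hB
  simp only [pairSumQ] at key ⊢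
  rw [pairSum_field_eq (B := N) hM hu hv hnM1 huv hunM hvnM hXu hXv,
    pairSum_field_eq (B := N) hM hw hw' hnm1 hww' hwnm hw'nm hXw hXw', eT1, eT3]
  linarith [key]

end HamiltonODE

end Literature.Geometry.Riemannian

end
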